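import Literature.NumberTheory.LFunctions.MoebiusWalshGeomSums
import Literature.NumberTheory.LFunctions.MoebiusWalshTypeIITools
import Literature.NumberTheory.LFunctions.VinogradovZetaSumLemmas
import HarnessLib

/-!
# Sums of the geometric-series kernel along arithmetic progressions (Mauduit–Rivat 2015, Lemmas 4–5; proved)

Everything in this file is PROVED. C. Mauduit, J. Rivat, *Prime numbers along Rudin–Shapiro
sequences*, J. Eur. Math. Soc. 17 (2015), §3: Lemma 4 ("For any `(a, m) ∈ ℤ²` with `m ≥ 1`,
`b ∈ ℝ` and `U > 0`, `∑_{0≤n<m} min(U, |sin π((an+b)/m)|⁻¹) ≪ gcd(a,m) U + m log m`", from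
Mauduit–Rivat 2010, Lemma 6) and Lemma 5 (its average over `1 ≤ a ≤ A`:
`≪ τ(m) U + m log m`, by `∑_{a≤A} gcd(a,m) ≤ A τ(m)`), the tools by which the `min` arising
from geometric sums (their (20)) are estimated on average in the type-I and type-II
propositions — hence inputs of Müllner's Thm. 4.4. We use the tree's kernel
`geomBound V x = min(V, 1/(2‖x‖))` (`Sieve.Vinogradov.geomBound`; `1/(2‖x‖) ≥ |sin πx|⁻¹/π`-wise
comparable and what the tree's geometric-sum bounds produce) and prove, with explicit constants,

* `sum_range_geomBound_progression_le` — **Lemma 4**: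
  `∑_{n<m} min(V, 1/(2‖(an+b)/m‖)) ≤ 2 gcd(a,m) V + m (1 + log m)`;
* `sum_Icc_gcd_le` — `∑_{1≤a≤A} gcd(a,m) ≤ A τ(m)`;
* `sum_sum_geomBound_progression_le` — **Lemma 5**:
  `∑_{1≤a≤A} ∑_{n<m} min(V, 1/(2‖(an+b)/m‖)) ≤ 2 A τ(m) V + A m (1 + log m)`.

## References
* C. Mauduit, J. Rivat, J. Eur. Math. Soc. 17 (2015), Lemmas 4 and 5 (pp. 2601–2602).
  [MauduitRivat2015]
* C. Mauduit, J. Rivat, Ann. of Math. 171 (2010), Lemme 6. [MauduitRivat2010]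
-/

noncomputable section

open Finset Real

namespace Literature.NumberTheory.LFunctions.MauduitRivat

open Literature.NumberTheory.Sieve.Vinogradov (geomBound distInt distInt_add_int geomBound_nonneg)
open Literature.NumberTheory.LFunctions.MoebiusWalsh (sum_range_geomBound_div_add_le)
open Literature.NumberTheory.LFunctions.VinogradovZetaSum (geomBound_add_int)
open Literature.NumberTheory.LFunctions.MoebiusWalshTypeII (sum_range_comp_mul_mod_eq)

/-- A `P`-periodic summand over `g` periods: `∑_{n<Pg} h(n) = g ∑_{n<P} h(n)`. [folklore] -/
theorem sum_range_mul_of_periodic {P g : ℕ} {h : ℕ → ℝ} (hper : ∀ n, h (n + P) = h n) :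
    ∑ n ∈ range (P * g), h n = g * ∑ n ∈ range P, h n := by
  induction g with
  | zero => simp
  | succ g ih =>
    rw [Nat.mul_succ, sum_range_add, ih]
    have hshift : ∀ t n : ℕ, h (P * t + n) = h n := by
      intro t
      induction t with
      | zero => intro n; rw [mul_zero, zero_add]
      | succ t iht => intro n; rw [Nat.mul_succ, add_right_comm, hper, iht]
    rw [sum_congr rfl fun n _ => hshift g n]
    push_cast; ring

/-- **Mauduit–Rivat 2015, Lemma 4** (kernel `min(V, 1/(2‖·‖))`):
`∑_{n<m} min(V, 1/(2‖(an+b)/m‖)) ≤ 2 gcd(a,m) V + m(1 + log m)` (`m ≥ 1`, `V ≥ 0`).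
The values `an mod m` run `gcd(a,m)` times over the multiples of `gcd(a,m)`, which are
`m/gcd(a,m)` equally spaced points. [cite: MauduitRivat2015, Lemma 4] -/
theorem sum_range_geomBound_progression_le {m : ℕ} (hm : 0 < m) (a : ℕ) (b : ℝ) {V : ℝ}
    (hV : 0 ≤ V) :
    ∑ n ∈ range m, geomBound V (((a : ℝ) * n + b) / m) ≤
      2 * (Nat.gcd a m) * V + m * (1 + Real.log m) := by
  set g := Nat.gcd a m with hg
  have hg0 : 0 < g := Nat.gcd_pos_of_pos_right a hm
  obtain ⟨m', hm'⟩ : ∃ m', m = g * m' := ⟨m / g, (Nat.mul_div_cancel' (Nat.gcd_dvd_right a m)).symm⟩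
  obtain ⟨a', ha'⟩ : ∃ a', a = g * a' := ⟨a / g, (Nat.mul_div_cancel' (Nat.gcd_dvd_left a m)).symm⟩
  have hm'0 : 0 < m' := by
    rcases Nat.eq_zero_or_pos m' with h | h
    · rw [h, mul_zero] at hm'; omega
    · exact h
  have hcop : Nat.Coprime a' m' := by
    have h := Nat.coprime_div_gcd_div_gcd (m := a) (n := m) hg0
    rw [← hg] at h
    have e1 : a / g = a' := by rw [ha', Nat.mul_div_cancel_left _ hg0]
    have e2 : m / g = m' := by rw [hm', Nat.mul_div_cancel_left _ hg0]
    rwa [e1, e2] at h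
  have hmR : (0 : ℝ) < m := by exact_mod_cast hm
  have hm'R : (0 : ℝ) < m' := by exact_mod_cast hm'0
  have hgR : (0 : ℝ) < g := by exact_mod_cast hg0
  -- (1) pointwise reduction to the multiples of `g`
  have hpt : ∀ n : ℕ, geomBound V (((a : ℝ) * n + b) / m) =
      geomBound V ((((a' * n % m' : ℕ) : ℝ)) / m' + b / m) := by
    intro n
    have hdecomp : (a : ℝ) * n = ((a * n / m : ℕ) : ℝ) * m + ((a * n % m : ℕ) : ℝ) := by
      have := Nat.div_add_mod (a * n) m
      have h' : ((m * (a * n / m) + a * n % m : ℕ) : ℝ) = ((a * n : ℕ) : ℝ) := by rw [this]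
      push_cast at h'
      linarith
    have hmod : ((a * n % m : ℕ) : ℝ) = g * ((a' * n % m' : ℕ) : ℝ) := by
      rw [ha', hm', mul_assoc, Nat.mul_mod_mul_left]; push_cast; ring
    have e : ((a : ℝ) * n + b) / m = ((((a' * n % m' : ℕ) : ℝ)) / m' + b / m) + ((a * n / m : ℕ) : ℝ) := by
      rw [hdecomp, hmod]
      have : (m : ℝ) = g * m' := by rw [hm']; push_cast; ring
      rw [this]
      field_simp
      ring
    rw [e, ← Int.cast_natCast (R := ℝ) (a * n / m), geomBound_add_int]
  rw [sum_congr rfl fun n _ => hpt n]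
  -- (2) periodicity in `n` with period `m'`, over `g` periods
  have hper : ∀ n, geomBound V ((((a' * (n + m') % m' : ℕ) : ℝ)) / m' + b / m) =
      geomBound V ((((a' * n % m' : ℕ) : ℝ)) / m' + b / m) := by
    intro n
    rw [mul_add, Nat.add_mul_mod_self_right]
  have hsplit : ∑ n ∈ range m, geomBound V ((((a' * n % m' : ℕ) : ℝ)) / m' + b / m) =
      g * ∑ n ∈ range m', geomBound V ((((a' * n % m' : ℕ) : ℝ)) / m' + b / m) := by
    rw [show range m = range (m' * g) by rw [hm', mul_comm]]
    exact sum_range_mul_of_periodic (P := m') (g := g)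
      (h := fun n => geomBound V ((((a' * n % m' : ℕ) : ℝ)) / m' + b / m)) hper
  rw [hsplit]
  -- (3) coprime reindexing and the equally spaced sum
  have hre := sum_range_comp_mul_mod_eq hm'0 hcop (fun j => geomBound V ((j : ℝ) / m' + b / m))
  rw [hre]
  have hhool := sum_range_geomBound_div_add_le hm'0 hV (b / m)
  have hlog : Real.log m' ≤ Real.log m := by
    apply Real.log_le_log hm'R
    have : m' ≤ m := by rw [hm']; exact Nat.le_mul_of_pos_left m' hg0
    exact_mod_cast this
  have hlog0 : 0 ≤ 1 + Real.log m' := by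
    have := Real.log_nonneg (show (1 : ℝ) ≤ m' by exact_mod_cast hm'0); linarith
  have hgm' : (g : ℝ) * m' = m := by rw [hm']; push_cast; ring
  calc (g : ℝ) * ∑ j ∈ range m', geomBound V ((j : ℝ) / m' + b / m)
      ≤ g * (2 * V + m' * (1 + Real.log m')) := by gcongr
    _ = 2 * g * V + m * (1 + Real.log m') := by rw [← hgm']; ring
    _ ≤ 2 * g * V + m * (1 + Real.log m) := by gcongr

/-- `∑_{1≤a≤A} gcd(a,m) ≤ A τ(m)` (`m ≥ 1`): group by `d = gcd(a,m) ∣ m`; at most `A/d` values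
of `a` are multiples of `d`. [cite: MauduitRivat2015, Lemma 5 (proof)] -/
theorem sum_Icc_gcd_le {m : ℕ} (hm : 0 < m) (A : ℕ) :
    ∑ a ∈ Icc 1 A, (Nat.gcd a m : ℝ) ≤ A * (m.divisors.card : ℝ) := by
  have key : ∀ a ∈ Icc 1 A, (Nat.gcd a m : ℝ) =
      ∑ d ∈ m.divisors, if Nat.gcd a m = d then (d : ℝ) else 0 := by
    intro a _
    rw [sum_ite_eq m.divisors (Nat.gcd a m) (fun d => (d : ℝ)), if_pos]
    exact Nat.mem_divisors.2 ⟨Nat.gcd_dvd_right a m, hm.ne'⟩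
  rw [sum_congr rfl key, sum_comm]
  calc ∑ d ∈ m.divisors, ∑ a ∈ Icc 1 A, (if Nat.gcd a m = d then (d : ℝ) else 0)
      ≤ ∑ d ∈ m.divisors, (d : ℝ) * (((Icc 1 A).filter (fun a => d ∣ a)).card : ℝ) := by
        refine sum_le_sum fun d hd => ?_
        rw [← sum_filter]
        calc ∑ a ∈ (Icc 1 A).filter (fun a => Nat.gcd a m = d), (d : ℝ)
            = (d : ℝ) * (((Icc 1 A).filter (fun a => Nat.gcd a m = d)).card : ℝ) := by
              rw [sum_const, nsmul_eq_mul, mul_comm]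
          _ ≤ (d : ℝ) * (((Icc 1 A).filter (fun a => d ∣ a)).card : ℝ) := by
              refine mul_le_mul_of_nonneg_left ?_ (Nat.cast_nonneg d)
              exact_mod_cast card_le_card (fun a ha => by
                rw [mem_filter] at ha ⊢
                exact ⟨ha.1, ha.2 ▸ Nat.gcd_dvd_left a m⟩)
    _ ≤ ∑ d ∈ m.divisors, (A : ℝ) := by
        refine sum_le_sum fun d hd => ?_
        have hd0 : 0 < d := Nat.pos_of_mem_divisors hd
        have hcard : ((Icc 1 A).filter (fun a => d ∣ a)).card ≤ A / d := by
          calc ((Icc 1 A).filter (fun a => d ∣ a)).card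
              ≤ ((Icc 1 (A / d)).image (fun j => d * j)).card := by
                refine card_le_card fun a ha => ?_
                rw [mem_filter, mem_Icc] at ha
                obtain ⟨⟨ha1, haA⟩, j, rfl⟩ := ha
                refine mem_image.2 ⟨j, mem_Icc.2 ⟨?_, ?_⟩, rfl⟩
                · rcases Nat.eq_zero_or_pos j with h | h
                  · rw [h, mul_zero] at ha1; omega
                  · exact h
                · rw [Nat.le_div_iff_mul_le hd0, mul_comm]; exact haA
            _ ≤ (Icc 1 (A / d)).card := card_image_le
            _ = A / d := by simp
        have h1 : (d : ℝ) * (((Icc 1 A).filter (fun a => d ∣ a)).card : ℝ) ≤ d * ((A / d : ℕ) : ℝ) := by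
          gcongr
        have h2 : (d : ℝ) * ((A / d : ℕ) : ℝ) ≤ A := by
          have : d * (A / d) ≤ A := Nat.mul_div_le A d
          exact_mod_cast this
        linarith
    _ = A * (m.divisors.card : ℝ) := by rw [sum_const, nsmul_eq_mul, mul_comm]

/-- **Mauduit–Rivat 2015, Lemma 5** (kernel `min(V, 1/(2‖·‖))`, explicit constants):
`∑_{1≤a≤A} ∑_{n<m} min(V, 1/(2‖(an+b)/m‖)) ≤ 2 A τ(m) V + A m (1 + log m)`.
[cite: MauduitRivat2015, Lemma 5] -/
theorem sum_sum_geomBound_progression_le {m : ℕ} (hm : 0 < m) (A : ℕ) (b : ℝ) {V : ℝ}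
    (hV : 0 ≤ V) :
    ∑ a ∈ Icc 1 A, ∑ n ∈ range m, geomBound V (((a : ℝ) * n + b) / m) ≤
      2 * A * (m.divisors.card : ℝ) * V + A * (m * (1 + Real.log m)) := by
  calc ∑ a ∈ Icc 1 A, ∑ n ∈ range m, geomBound V (((a : ℝ) * n + b) / m)
      ≤ ∑ a ∈ Icc 1 A, (2 * (Nat.gcd a m) * V + m * (1 + Real.log m)) :=
        sum_le_sum fun a _ => sum_range_geomBound_progression_le hm a b hV
    _ = 2 * V * ∑ a ∈ Icc 1 A, (Nat.gcd a m : ℝ) + A * (m * (1 + Real.log m)) := by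
        rw [sum_add_distrib, sum_const, Nat.card_Icc, Nat.add_sub_cancel, nsmul_eq_mul, mul_sum]
        congr 1
        exact sum_congr rfl fun a _ => by ring
    _ ≤ 2 * V * (A * (m.divisors.card : ℝ)) + A * (m * (1 + Real.log m)) := by
        gcongr
        exact sum_Icc_gcd_le hm A
    _ = 2 * A * (m.divisors.card : ℝ) * V + A * (m * (1 + Real.log m)) := by ring

end Literature.NumberTheory.LFunctions.MauduitRivat
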